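import Summits.QuantumFields.BalabanUV.Beta.WardBorderJointModel

/-!
# `BalabanUV.Beta.WardBorderJointModelOne` — binder row D1, (L4): hR ∧ hW FOR ONE AND THE SAME `Js` TERM (the jointly-modelled wall literal)
# (β sub-cell, D1 formalisation swarm, unit `b2b-balaban-beta-d1-formalise-leaf-06`, gen 5; «D1-hRhW-BORDER-JOINT-WARD-MODEL» part D2, one-`Js` corollary)

HONEST FRAMING (cell charter, verbatim): «discharging `BetaPertH` makes Bałaban's UV stability UNCONDITIONAL — a real constructive-QFT
result; it is NOT the continuum limit and NOT the Clay problem.»  HONEST DEPENDENCY (verbatim): «continuum YM on T⁴ ⇐ BetaPertH ∧ nine spine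
estimates (0/9 proved); BetaPertH ⇐ (D1) ∧ (D4) ∧ CAP+tail; G-an2-4 gates asym, D1 and NE2/3/4.»  [folklore] one `ring` rewrite joining the two
spellings of the vh-weight (`−(Lc^{3+1}·½·Lc^{3+1})` in leaf-06's hW END, `−(Lc⁸∕2)` in the hR END) so that BOTH symmetry binders of
`OneStepKernelFamily.d1Drift_of_D1Tel_D1Rep` are stated for ONE `Js` term (referee I-d1ref15-1 «one Js across hR∕hW»).  No statement of Bałaban's papers,
no `[cite:]`, no `def`; the literal is the MODEL literal (`vh₂SJoint`, `Mjoint` [our object]) — NOT the literal of record `JsRowD1Pin` with an1's tables;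
instantiates NO binder of the β-function wall (0/4: hW, hR, D1Tel, D1Rep).  NOT D1, NOT `BetaPertH`, NOT continuum, NOT Clay.
Provenance: D1 formalisation swarm, leaf prover 06 (gen 5), 2026-08-20; no existing file touched.
-/

noncomputable section

open Literature.MathematicalPhysics.QuantumFieldTheory
open Literature.MathematicalPhysics.QuantumFieldTheory.Balaban1983to89
open Literature.MathematicalPhysics.QuantumFieldTheory.Balaban1983to89.Beta
open AveragingContoursRooted (ctrOff ctrOff_mem_box)
open OneStepKernelFamily (TbalOf flipK)
open BalabanStepJetsSucc (wVH)
open PolarizationSign (AxisReflectionCovariant WardTransversal)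
open WilsonVertex2Sym (wsym22)
open Summit.QuantumFields.BalabanUV.Beta.TameKernelCalculus
open Summit.QuantumFields.BalabanUV.Beta.BorderedHessian (stepScale)
open Summit.QuantumFields.BalabanUV.Beta.SpineRooted (JsRecWAtOf)
open Summit.QuantumFields.BalabanUV.Beta.WardMixedJointModel (locStencilFM_Mjoint)
open Summit.QuantumFields.BalabanUV.Beta.WardBorderJointModel (locStencil₂_vh₂SJoint hR_and_hW_jointWard_pinned)

namespace Summit.QuantumFields.BalabanUV.Beta.WardBorderJointModelOne

variable {Lc : ℕ} [NeZero Lc]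

/-- [folklore] **hR ∧ hW FOR ONE `Js` TERM, NO LETTER HYPOTHESIS**: for odd `Lc`, `2 ≤ N`, any `cΛ`, any `cB ≠ 0`, the fully-modelled `SU(N)` wall literal
`Js := JsRecWAtOf (Lc⁴) (−Lc⁸∕2) cΛ (Lc⁸) cB T_W (locStencil₂_vh₂SJoint …) (locStencilFM_Mjoint …)` (γ pinned to the END's formula) satisfies
`(∀ j, AxisReflectionCovariant (flipK (TbalOf Lc Js j))) ∧ (∀ j, WardTransversal (flipK (TbalOf Lc Js j)))` — the `hR` and `hW` binders of
`OneStepKernelFamily.d1Drift_of_D1Tel_D1Rep` at this `Js`, both discharged (`WardBorderJointModel.hR_and_hW_jointWard_pinned` + one `ring` rewrite of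
the vh-weight spelling). -/
theorem hR_and_hW_one_Js (hLc : Odd Lc) {N : ℕ} (hN : 2 ≤ N) (cΛ cB : ℝ) (hcB : cB ≠ 0) :
    (∀ j : ℕ, AxisReflectionCovariant
      (flipK (TbalOf Lc (JsRecWAtOf (d := 3) hLc.pos (ctrOff_mem_box hLc.pos) ((Lc : ℝ) ^ 4) (-((Lc : ℝ) ^ 8 / 2)) cΛ ((Lc : ℝ) ^ 8) cB
        ((8 * (N : ℝ) ^ 2)⁻¹ • wsym22 N)
        (locStencil₂_vh₂SJoint hLc cΛ cB (fun j => -((Lc : ℝ) ^ 8 / 2) * wVH 3 Lc j / (stepScale 3 Lc j * (Lc : ℝ) ^ 4)))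
        (locStencilFM_Mjoint hLc cΛ)) j))) ∧
    (∀ j : ℕ, WardTransversal
      (flipK (TbalOf Lc (JsRecWAtOf (d := 3) hLc.pos (ctrOff_mem_box hLc.pos) ((Lc : ℝ) ^ 4) (-((Lc : ℝ) ^ 8 / 2)) cΛ ((Lc : ℝ) ^ 8) cB
        ((8 * (N : ℝ) ^ 2)⁻¹ • wsym22 N)
        (locStencil₂_vh₂SJoint hLc cΛ cB (fun j => -((Lc : ℝ) ^ 8 / 2) * wVH 3 Lc j / (stepScale 3 Lc j * (Lc : ℝ) ^ 4)))
        (locStencilFM_Mjoint hLc cΛ)) j))) := by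
  obtain ⟨hR, hW⟩ := hR_and_hW_jointWard_pinned hLc hN cΛ cB hcB
  have e : (-((Lc : ℝ) ^ (3 + 1) * (1 / 2) * (Lc : ℝ) ^ (3 + 1))) = -((Lc : ℝ) ^ 8 / 2) := by ring
  rw [e] at hW
  exact ⟨hR, hW⟩

end Summit.QuantumFields.BalabanUV.Beta.WardBorderJointModelOne

end
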